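import Mathlib.Analysis.SpecialFunctions.ImproperIntegrals
import Mathlib.MeasureTheory.Measure.Lebesgue.EqHaar
import Summits.KontsevichZagierPeriods.KontsevichZagierPeriods.Theorems.SoloBlindZetaTwoWedge
import Summits.KontsevichZagierPeriods.KontsevichZagierPeriods.Theorems.SoloBlindBoxRankOne
import HarnessLib

/-!
# Kontsevich–Zagier's `ζ(2) = π²/6` inside the three rules, II: the representations

The cast of the move-theoretic proof of `ζ(2) = π²/6` (charts in `SoloBlindZetaTwoCharts`,
`SoloBlindZetaTwoWedge`; the moves in `SoloBlindZetaTwo`), each an `IntegralRep 2` of KZ's literal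
rational shape, pinned by domain and integrand:

* `zetaTwoRep`      `Z  = [T, 1/((1-x)y)]`, `T = {0<x<y<1}` — Kontsevich–Zagier's eq. (2)
  for `ζ(2)`;
* `zetaTwoEven`     `A  = [T, 1/((1-x²)y)]`, `zetaTwoOdd` `B = [T, x/((1-x²)y)]` (so `Z = A + B`),
  `zetaTwoQuarter`  `[T, 1/(4(1-x)y)]` (the image of `B` under `(x,y) ↦ (x²,y²)`);
* `parabolicRep`    `J  = [U, 1/(2(1-u²)v)]`, `U = {0<u<1, u²<v<1}` (the image of `A` under
  `(x,y) ↦ (x,y²)` and of the wedge integral under the wedge chart);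
* `wedgeRep`, `cowedgeRep`, `wedgeClosedRep`, `diagRep`, `quadrantRep`: the kernel
  `k = 1/((1+x²)(1+y²))` on `{0<y<x}`, `{0<x<y}`, `{0<y≤x}`, `{0<y=x}`, `{x,y>0}`;
* `arctanHalfLine`  `P  = [(0,∞), 1/(1+x²)]` (value `π/2`), whose square is `quadrantRep` up to
  the product move, and `piSqSixthRep` `R = [{x,y>0}, 2/(3(1+x²)(1+y²))]` (value `π²/6`).

Absolute convergence of `Z` — the only analytic input besides `∫₀^∞ dx/(1+x²) = π/2` — is
obtained by transporting the integrability of `k ⊗`-product backwards along the three charts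
(`integrableOn_iff_of_chart`), so that no two-dimensional integral is ever evaluated.

References: M. Kontsevich, D. Zagier, *Periods* (2001), §1.1 (the two representations of `π`),
§1.2 (eq. (2) and the `ζ(2)` question).
-/

noncomputable section

namespace Summit.KontsevichZagierPeriods.KontsevichZagierPeriods.Theorems

open Set MeasureTheory
open Literature.ModelTheory.ExponentialFields (IsSemialgebraic isSemialgebraic_setOf_eval_pos
  isSemialgebraic_setOf_eval_le isSemialgebraic_setOf_eval_eq_zero)
open MvPolynomial (aeval X)
open Literature.NumberTheory.Transcendental
open Literature.NumberTheory.Transcendental.KZ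

namespace SoloBlind

variable {n : ℕ}

/-! ## Rational representations with a pinned integrand -/

/-- `[σ, f]` with the integrand pinned as an explicit function `f` that agrees on `σ` with a
quotient `p/q` of `ℚ`-polynomials, `q ≠ 0` on `σ`: KZ's literal rational shape, with a usable
`integrand` field. -/
def ratRep (σ : Set (Fin n → ℝ)) (f : (Fin n → ℝ) → ℝ) (p q : MvPolynomial (Fin n) ℚ)
    (hσ : IsSemialgebraic ℚ σ) (hq : ∀ x ∈ σ, aeval x q ≠ 0)
    (hf : ∀ x ∈ σ, f x = aeval x p / aeval x q) (hint : IntegrableOn f σ) : IntegralRep n where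
  domain := σ
  integrand := f
  isSemialgebraic_domain := hσ
  isSemialgebraicFunOn_integrand :=
    (isSemialgebraicFunOn_aeval_div_aeval hσ p q hq).congr fun x hx => (hf x hx).symm
  integrableOn := hint

section ratRep

variable {σ : Set (Fin n → ℝ)} {f : (Fin n → ℝ) → ℝ} {p q : MvPolynomial (Fin n) ℚ}
  {hσ : IsSemialgebraic ℚ σ} {hq : ∀ x ∈ σ, aeval x q ≠ 0}
  {hf : ∀ x ∈ σ, f x = aeval x p / aeval x q} {hint : IntegrableOn f σ}

/-- The domain of `ratRep σ f …` is `σ`. -/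
@[simp] theorem ratRep_domain : (ratRep σ f p q hσ hq hf hint).domain = σ := rfl

/-- The integrand of `ratRep σ f …` is `f`. -/
@[simp] theorem ratRep_integrand : (ratRep σ f p q hσ hq hf hint).integrand = f := rfl

/-- `ratRep σ f p q …` has KZ's literal rational shape. -/
theorem isRational_ratRep : (ratRep σ f p q hσ hq hf hint).IsRational := ⟨p, q, hq, hf⟩

end ratRep

/-! ## `P = [(0, ∞), 1/(1+x²)]` -/

/-- `x ↦ 1/(1+x²)` is integrable on `(0, ∞)`. -/
theorem integrableOn_inv_one_add_sq_Ioi :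
    IntegrableOn (fun t : ℝ => 1 / (1 + t ^ 2)) (Ioi 0) :=
  integrable_inv_one_add_sq.integrableOn.congr_fun (fun t _ => by rw [one_div]) measurableSet_Ioi

/-- **`P = [(0, ∞), 1/(1+x²)]`**, half of Kontsevich–Zagier's second representation of `π`. -/
def arctanHalfLine : IntegralRep 1 :=
  lineRep (Ioi 0) (fun t => 1 / (1 + t ^ 2)) (isSemialgebraic_line_Ioi isAlgebraic_zero)
    (isSemialgebraicFunOn_atan_integrand isAlgebraic_one
      (isSemialgebraic_line_Ioi isAlgebraic_zero))
    integrableOn_inv_one_add_sq_Ioi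

/-- `value P = π/2`. -/
theorem arctanHalfLine_value : arctanHalfLine.value = Real.pi / 2 := by
  rw [arctanHalfLine, value_lineRep]
  simp [one_div]

/-- `P` has KZ's literal rational shape. -/
theorem isRational_arctanHalfLine : arctanHalfLine.IsRational := by
  refine ⟨1, 1 + X 0 ^ 2, fun x _ => ?_, fun x _ => ?_⟩
  · have : (0:ℝ) < 1 + x 0 ^ 2 := by positivity
    simpa using this.ne'
  · simp [arctanHalfLine]

/-! ## More planar domains: quadrant, closed wedge, co-wedge, diagonal -/

/-- The open positive quadrant `{x > 0, y > 0}`. -/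
def kzQuadrant : Set (Fin 2 → ℝ) := {z | 0 < z 0 ∧ 0 < z 1}

/-- The wedge with its diagonal edge, `{0 < y ≤ x}`. -/
def kzWedgeClosed : Set (Fin 2 → ℝ) := {z | 0 < z 1 ∧ z 1 ≤ z 0}

/-- The open diagonal ray `{0 < y = x}` (a null set). -/
def kzDiag : Set (Fin 2 → ℝ) := {z | 0 < z 1 ∧ z 1 = z 0}

/-- Membership in the quadrant, unfolded. -/
theorem mem_kzQuadrant {z : Fin 2 → ℝ} : z ∈ kzQuadrant ↔ 0 < z 0 ∧ 0 < z 1 := Iff.rfl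

/-- Membership in the closed wedge, unfolded. -/
theorem mem_kzWedgeClosed {z : Fin 2 → ℝ} : z ∈ kzWedgeClosed ↔ 0 < z 1 ∧ z 1 ≤ z 0 := Iff.rfl

/-- Membership in the diagonal, unfolded. -/
theorem mem_kzDiag {z : Fin 2 → ℝ} : z ∈ kzDiag ↔ 0 < z 1 ∧ z 1 = z 0 := Iff.rfl

/-- The quadrant is `ℚ`-semialgebraic. -/
theorem isSemialgebraic_kzQuadrant : IsSemialgebraic ℚ kzQuadrant := by
  have h := isSemialgebraic_setOf_forall_aeval_pos ![X 0, (X 1 : MvPolynomial (Fin 2) ℚ)]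
  convert h using 1
  ext x
  simp only [kzQuadrant, mem_setOf_eq, Fin.forall_fin_succ, Matrix.cons_val_zero,
    Matrix.cons_val_succ, MvPolynomial.aeval_X]
  exact ⟨fun ⟨h0, h1⟩ => ⟨h0, h1, fun i => Fin.elim0 i⟩, fun ⟨h0, h1, _⟩ => ⟨h0, h1⟩⟩

/-- The closed wedge is `ℚ`-semialgebraic. -/
theorem isSemialgebraic_kzWedgeClosed : IsSemialgebraic ℚ kzWedgeClosed := by
  convert (isSemialgebraic_setOf_eval_pos (R := ℝ) (X 1 : MvPolynomial (Fin 2) ℚ)).inter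
    (isSemialgebraic_setOf_eval_le (R := ℝ) (X 1) (X 0 : MvPolynomial (Fin 2) ℚ)) using 1
  ext z
  simp [kzWedgeClosed]

/-- The diagonal is `ℚ`-semialgebraic. -/
theorem isSemialgebraic_kzDiag : IsSemialgebraic ℚ kzDiag := by
  convert (isSemialgebraic_setOf_eval_pos (R := ℝ) (X 1 : MvPolynomial (Fin 2) ℚ)).inter
    (isSemialgebraic_setOf_eval_eq_zero (R := ℝ) (X 1 - X 0 : MvPolynomial (Fin 2) ℚ)) using 1
  ext z
  simp [kzDiag, sub_eq_zero]

/-- The quadrant is measurable. -/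
theorem measurableSet_kzQuadrant : MeasurableSet kzQuadrant :=
  isSemialgebraic_kzQuadrant.measurableSet_holds

/-- The closed wedge is measurable. -/
theorem measurableSet_kzWedgeClosed : MeasurableSet kzWedgeClosed :=
  isSemialgebraic_kzWedgeClosed.measurableSet_holds

/-- **The diagonal is Lebesgue-null** (it lies in the proper subspace `{y = x}`). -/
theorem volume_kzDiag : volume kzDiag = 0 := by
  let L : (Fin 2 → ℝ) →ₗ[ℝ] ℝ :=
    LinearMap.proj (R := ℝ) (φ := fun _ : Fin 2 => ℝ) 1 -
      LinearMap.proj (R := ℝ) (φ := fun _ : Fin 2 => ℝ) 0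
  have hS : LinearMap.ker L ≠ ⊤ := by
    intro h
    have h1 : (![1, 0] : Fin 2 → ℝ) ∈ LinearMap.ker L := h ▸ Submodule.mem_top
    rw [LinearMap.mem_ker] at h1
    simp [L] at h1
  refine measure_mono_null (fun z hz => ?_) (Measure.addHaar_submodule volume (LinearMap.ker L) hS)
  rw [mem_kzDiag] at hz
  rw [SetLike.mem_coe, LinearMap.mem_ker]
  simp [L, hz.2]

/-! ## The kernel `k = 1/((1+x²)(1+y²))` and `P × P` -/

/-- The domain of `P × P` is the quadrant. -/
theorem prod_arctanHalfLine_domain :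
    (arctanHalfLine.prod arctanHalfLine).domain = kzQuadrant := by
  ext z
  simp only [IntegralRep.prod_domain, IntegralRep.mem_prodDomain, arctanHalfLine, lineRep_domain,
    mem_line, mem_Ioi,
    (show (Fin.castAdd 1 (0 : Fin 1) : Fin 2) = 0 from rfl),
    (show (Fin.natAdd 1 (0 : Fin 1) : Fin 2) = 1 from rfl)]
  exact Iff.rfl

/-- The integrand of `P × P` is the kernel `k`. -/
theorem prod_arctanHalfLine_integrand (z : Fin 2 → ℝ) :
    (arctanHalfLine.prod arctanHalfLine).integrand z = 1 / ((1 + z 0 ^ 2) * (1 + z 1 ^ 2)) := by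
  rw [IntegralRep.prod_integrand_eq, IntegralRep.prodFun_apply]
  simp only [arctanHalfLine, lineRep_integrand,
    (show (Fin.castAdd 1 (0 : Fin 1) : Fin 2) = 0 from rfl),
    (show (Fin.natAdd 1 (0 : Fin 1) : Fin 2) = 1 from rfl)]
  rw [one_div_mul_one_div]

/-! ## Absolute convergence, transported backwards along the charts -/

/-- `k` is integrable on the quadrant (it is the integrand of `P × P`). -/
theorem integrableOn_kernel_quadrant :
    IntegrableOn (fun z : Fin 2 → ℝ => 1 / ((1 + z 0 ^ 2) * (1 + z 1 ^ 2))) kzQuadrant := by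
  have h := (arctanHalfLine.prod arctanHalfLine).integrableOn
  rw [prod_arctanHalfLine_domain] at h
  exact h.congr_fun (fun z _ => prod_arctanHalfLine_integrand z) measurableSet_kzQuadrant

/-- `k` is integrable on the open wedge. -/
theorem integrableOn_kernel_wedge :
    IntegrableOn (fun z : Fin 2 → ℝ => 1 / ((1 + z 0 ^ 2) * (1 + z 1 ^ 2))) kzWedge :=
  integrableOn_kernel_quadrant.mono_set fun _ hz => ⟨hz.1.trans hz.2, hz.1⟩

/-- `k` is integrable on the closed wedge. -/
theorem integrableOn_kernel_wedgeClosed :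
    IntegrableOn (fun z : Fin 2 → ℝ => 1 / ((1 + z 0 ^ 2) * (1 + z 1 ^ 2))) kzWedgeClosed :=
  integrableOn_kernel_quadrant.mono_set fun _ hz => ⟨hz.1.trans_le hz.2, hz.1⟩

/-- `k` is integrable on the (null) diagonal. -/
theorem integrableOn_kernel_diag :
    IntegrableOn (fun z : Fin 2 → ℝ => 1 / ((1 + z 0 ^ 2) * (1 + z 1 ^ 2))) kzDiag := by
  rw [IntegrableOn, Measure.restrict_eq_zero.mpr volume_kzDiag]
  exact integrable_zero_measure

/-- **`1/(2(1-u²)v)` is integrable on `U`** — by the wedge chart, from integrability of `k`. -/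
theorem integrableOn_parabolic :
    IntegrableOn (fun w : Fin 2 → ℝ => 1 / (2 * (1 - w 0 ^ 2) * w 1)) kzParabolic := by
  obtain ⟨Ψ, Ψ', hΨ0, hΨ1, -, hderiv, hinj, himage, hdet⟩ := exists_wedgeChart
  rw [← himage]
  refine (integrableOn_iff_of_chart measurableSet_kzWedge hderiv hinj hdet
    (f := fun z : Fin 2 → ℝ => 1 / ((1 + z 0 ^ 2) * (1 + z 1 ^ 2)))
    (g := fun w : Fin 2 → ℝ => 1 / (2 * (1 - w 0 ^ 2) * w 1)) fun z hz => ?_).mpr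
    integrableOn_kernel_wedge
  simp only [hΨ0, hΨ1]
  exact wedge_pullback hz.1 hz.2

/-- **`1/((1-x²)y)` is integrable on `T`** — by the half-square chart, from the previous one. -/
theorem integrableOn_even_triangle :
    IntegrableOn (fun z : Fin 2 → ℝ => 1 / ((1 - z 0 ^ 2) * z 1)) kzTriangle := by
  obtain ⟨Φ, Φ', hΦ0, hΦ1, -, hderiv, hinj, himage, hdet⟩ := exists_halfSquareChart
  have h := integrableOn_parabolic
  rw [← himage] at h
  refine (integrableOn_iff_of_chart measurableSet_kzTriangle hderiv hinj hdet
    (f := fun z : Fin 2 → ℝ => 1 / ((1 - z 0 ^ 2) * z 1))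
    (g := fun w : Fin 2 → ℝ => 1 / (2 * (1 - w 0 ^ 2) * w 1)) fun z hz => ?_).mp h
  simp only [hΦ0, hΦ1]
  rw [mem_kzTriangle] at hz
  have h1 : z 1 ≠ 0 := (hz.1.trans hz.2.1).ne'
  have h2 : 1 - z 0 ^ 2 ≠ 0 := by nlinarith [hz.1, hz.2.1, hz.2.2]
  field_simp

/-- **`x/((1-x²)y)` is integrable on `T`** — dominated by `1/((1-x²)y)` there. -/
theorem integrableOn_odd_triangle :
    IntegrableOn (fun z : Fin 2 → ℝ => z 0 / ((1 - z 0 ^ 2) * z 1)) kzTriangle := by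
  refine Integrable.mono' integrableOn_even_triangle ?_ ?_
  · refine ContinuousOn.aestronglyMeasurable ?_ measurableSet_kzTriangle
    refine (continuous_apply 0).continuousOn.div (Continuous.continuousOn (by fun_prop)) ?_
    intro z hz
    rw [mem_kzTriangle] at hz
    have h1 : 0 < z 1 := hz.1.trans hz.2.1
    have h2 : 0 < 1 - z 0 ^ 2 := by nlinarith [hz.1, hz.2.1, hz.2.2]
    exact (mul_pos h2 h1).ne'
  · refine ae_restrict_of_forall_mem measurableSet_kzTriangle fun z hz => ?_
    rw [mem_kzTriangle] at hz
    have h1 : 0 < z 1 := hz.1.trans hz.2.1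
    have h2 : 0 < 1 - z 0 ^ 2 := by nlinarith [hz.1, hz.2.1, hz.2.2]
    rw [Real.norm_eq_abs, abs_of_pos (div_pos hz.1 (mul_pos h2 h1))]
    exact div_le_div_of_nonneg_right (by linarith [hz.2.1, hz.2.2]) (mul_pos h2 h1).le

/-- **Kontsevich–Zagier's `ζ(2)` integrand `1/((1-x)y)` is absolutely integrable on `T`**
(`= 1/((1-x²)y) + x/((1-x²)y)`). -/
theorem integrableOn_zetaTwo_triangle :
    IntegrableOn (fun z : Fin 2 → ℝ => 1 / ((1 - z 0) * z 1)) kzTriangle := by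
  have h : IntegrableOn ((fun z : Fin 2 → ℝ => 1 / ((1 - z 0 ^ 2) * z 1)) +
      fun z : Fin 2 → ℝ => z 0 / ((1 - z 0 ^ 2) * z 1)) kzTriangle :=
    Integrable.add integrableOn_even_triangle integrableOn_odd_triangle
  refine h.congr_fun (fun z hz => ?_) measurableSet_kzTriangle
  rw [mem_kzTriangle] at hz
  have h1 : z 1 ≠ 0 := (hz.1.trans hz.2.1).ne'
  have h2 : 1 - z 0 ≠ 0 := by linarith [hz.2.1, hz.2.2]
  have h3 : 1 + z 0 ≠ 0 := by linarith [hz.1]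
  have h4 : 1 - z 0 ^ 2 = (1 - z 0) * (1 + z 0) := by ring
  simp only [Pi.add_apply, h4]
  field_simp

/-- `1/(4(1-x)y)` is integrable on `T`. -/
theorem integrableOn_zetaTwoQuarter_triangle :
    IntegrableOn (fun z : Fin 2 → ℝ => 1 / (4 * ((1 - z 0) * z 1))) kzTriangle :=
  IntegrableOn.congr_fun (Integrable.const_mul integrableOn_zetaTwo_triangle (1 / 4))
    (fun z _ => by rw [one_div_mul_one_div]) measurableSet_kzTriangle

/-! ## The representations -/

/-- **Kontsevich–Zagier's `ζ(2)`**: `Z = [T, 1/((1-x)y)]`, `T = {0 < x < y < 1}` (*Periods*,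
§1.2, eq. (2)). -/
def zetaTwoRep : IntegralRep 2 :=
  ratRep kzTriangle (fun z => 1 / ((1 - z 0) * z 1)) 1 ((1 - X 0) * X 1) isSemialgebraic_kzTriangle
    (fun z hz => by
      rw [mem_kzTriangle] at hz
      simp only [map_mul, map_sub, map_one, MvPolynomial.aeval_X]
      exact mul_ne_zero (by linarith [hz.2.1, hz.2.2]) (hz.1.trans hz.2.1).ne')
    (fun z _ => by simp) integrableOn_zetaTwo_triangle

/-- `A = [T, 1/((1-x²)y)]`, the even part of `Z`. -/
def zetaTwoEven : IntegralRep 2 :=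
  ratRep kzTriangle (fun z => 1 / ((1 - z 0 ^ 2) * z 1)) 1 ((1 - X 0 ^ 2) * X 1)
    isSemialgebraic_kzTriangle
    (fun z hz => by
      rw [mem_kzTriangle] at hz
      simp only [map_mul, map_sub, map_one, map_pow, MvPolynomial.aeval_X]
      exact mul_ne_zero (by nlinarith [hz.1, hz.2.1, hz.2.2]) (hz.1.trans hz.2.1).ne')
    (fun z _ => by simp) integrableOn_even_triangle

/-- `B = [T, x/((1-x²)y)]`, the odd part of `Z`. -/
def zetaTwoOdd : IntegralRep 2 :=
  ratRep kzTriangle (fun z => z 0 / ((1 - z 0 ^ 2) * z 1)) (X 0) ((1 - X 0 ^ 2) * X 1)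
    isSemialgebraic_kzTriangle
    (fun z hz => by
      rw [mem_kzTriangle] at hz
      simp only [map_mul, map_sub, map_one, map_pow, MvPolynomial.aeval_X]
      exact mul_ne_zero (by nlinarith [hz.1, hz.2.1, hz.2.2]) (hz.1.trans hz.2.1).ne')
    (fun z _ => by simp) integrableOn_odd_triangle

/-- `[T, 1/(4(1-x)y)]`, a quarter of `Z` (the image of `B` under the square chart). -/
def zetaTwoQuarter : IntegralRep 2 :=
  ratRep kzTriangle (fun z => 1 / (4 * ((1 - z 0) * z 1))) 1 (4 * ((1 - X 0) * X 1))
    isSemialgebraic_kzTriangle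
    (fun z hz => by
      rw [mem_kzTriangle] at hz
      simp only [map_mul, map_sub, map_one, map_ofNat, MvPolynomial.aeval_X]
      exact mul_ne_zero four_ne_zero
        (mul_ne_zero (by linarith [hz.2.1, hz.2.2]) (hz.1.trans hz.2.1).ne'))
    (fun z _ => by simp) integrableOn_zetaTwoQuarter_triangle

/-- `J = [U, 1/(2(1-u²)v)]`, `U = {0 < u < 1, u² < v < 1}`. -/
def parabolicRep : IntegralRep 2 :=
  ratRep kzParabolic (fun w => 1 / (2 * (1 - w 0 ^ 2) * w 1)) 1 (2 * (1 - X 0 ^ 2) * X 1)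
    isSemialgebraic_kzParabolic
    (fun w hw => by
      rw [mem_kzParabolic] at hw
      simp only [map_mul, map_sub, map_one, map_pow, map_ofNat, MvPolynomial.aeval_X]
      have h1 : 0 < w 1 := lt_of_le_of_lt (sq_nonneg _) hw.2.2.1
      exact mul_ne_zero (mul_ne_zero two_ne_zero (by nlinarith [hw.1, hw.2.1])) h1.ne')
    (fun w _ => by simp) integrableOn_parabolic

/-- The nonvanishing of `(1+x²)(1+y²)`, as needed by `ratRep`. -/
theorem aeval_kernel_denominator_ne_zero (z : Fin 2 → ℝ) :
    aeval z ((1 + X 0 ^ 2) * (1 + X 1 ^ 2) : MvPolynomial (Fin 2) ℚ) ≠ 0 := by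
  simp only [map_mul, map_add, map_one, map_pow, MvPolynomial.aeval_X]
  positivity

/-- `I = [W, k]`: the kernel on the open wedge `{0 < y < x}`. -/
def wedgeRep : IntegralRep 2 :=
  ratRep kzWedge (fun z => 1 / ((1 + z 0 ^ 2) * (1 + z 1 ^ 2))) 1 ((1 + X 0 ^ 2) * (1 + X 1 ^ 2))
    isSemialgebraic_kzWedge (fun z _ => aeval_kernel_denominator_ne_zero z) (fun z _ => by simp)
    integrableOn_kernel_wedge

/-- `I' = [W', k]`: the kernel on the co-wedge `{0 < x < y}`, as the coordinate swap of `I`. -/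
def cowedgeRep : IntegralRep 2 := wedgeRep.reindex (Equiv.swap 0 1)

/-- `[W⁺, k]`: the kernel on the closed wedge `{0 < y ≤ x}`. -/
def wedgeClosedRep : IntegralRep 2 :=
  ratRep kzWedgeClosed (fun z => 1 / ((1 + z 0 ^ 2) * (1 + z 1 ^ 2))) 1
    ((1 + X 0 ^ 2) * (1 + X 1 ^ 2)) isSemialgebraic_kzWedgeClosed
    (fun z _ => aeval_kernel_denominator_ne_zero z) (fun z _ => by simp)
    integrableOn_kernel_wedgeClosed

/-- `[Δ, k]`: the kernel on the null diagonal `{0 < y = x}`. -/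
def diagRep : IntegralRep 2 :=
  ratRep kzDiag (fun z => 1 / ((1 + z 0 ^ 2) * (1 + z 1 ^ 2))) 1 ((1 + X 0 ^ 2) * (1 + X 1 ^ 2))
    isSemialgebraic_kzDiag (fun z _ => aeval_kernel_denominator_ne_zero z) (fun z _ => by simp)
    integrableOn_kernel_diag

/-- `K = [{x,y>0}, k]`: the kernel on the quadrant (equal to `P × P` up to a trivial move). -/
def quadrantRep : IntegralRep 2 :=
  ratRep kzQuadrant (fun z => 1 / ((1 + z 0 ^ 2) * (1 + z 1 ^ 2))) 1
    ((1 + X 0 ^ 2) * (1 + X 1 ^ 2)) isSemialgebraic_kzQuadrant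
    (fun z _ => aeval_kernel_denominator_ne_zero z) (fun z _ => by simp)
    integrableOn_kernel_quadrant

/-- **`R = [{x,y>0}, 2/(3(1+x²)(1+y²))]`**, the representation of `π²/6` at which the proof
arrives. -/
def piSqSixthRep : IntegralRep 2 :=
  ratRep kzQuadrant (fun z => 2 / (3 * ((1 + z 0 ^ 2) * (1 + z 1 ^ 2)))) 2
    (3 * ((1 + X 0 ^ 2) * (1 + X 1 ^ 2))) isSemialgebraic_kzQuadrant
    (fun z _ => by
      simp only [map_mul, map_add, map_one, map_pow, map_ofNat, MvPolynomial.aeval_X]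
      positivity)
    (fun z _ => by simp)
    (IntegrableOn.congr_fun (Integrable.const_mul integrableOn_kernel_quadrant (2 / 3))
      (fun z _ => by rw [div_mul_div_comm, mul_one]) measurableSet_kzQuadrant)

/-- `Z` has KZ's literal rational shape. -/
theorem isRational_zetaTwoRep : zetaTwoRep.IsRational := isRational_ratRep

/-- `R` has KZ's literal rational shape. -/
theorem isRational_piSqSixthRep : piSqSixthRep.IsRational := isRational_ratRep

end SoloBlind

end Summit.KontsevichZagierPeriods.KontsevichZagierPeriods.Theorems
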